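import Summits.Ventures.LatticeQCDFlow.Exactness.IMHColdStartMSELimit
import HarnessLib

/-!
# The empirically centred autocovariance of an exact sampler's equilibrium run is biased by `O(σ²_f/N)` at every lag:
# an exact expectation for every stationary Markov chain and a certified `2(2w − 1)·Var/N` bound for flow-MCMC

HONEST FRAMING: exact (Metropolis-corrected) sampling algorithms for lattice gauge theory;
figures of merit are autocorrelation/cost numbers at stated couplings and volumes; no
continuum-physics claim.

Venture `LatticeQCDFlow` (cell pub-lqcd), topic `Exactness`; FANOUT row 30 (lean-1, GEN-33).  NEW WORK of the
cell, general state space.  The Γ-method's input is the EMPIRICALLY CENTRED lag sum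
`S_u = Σ_{i<N−u}(f(X_i) − m_N)(f(X_{i+u}) − m_N)`, `m_N = (1/N)Σ_{j<N} f(X_j)` (the tree's scorer A:
`Scoring/SampleACFSumZero`, `Scoring/ChainTauIntEmpiricalVariance` — consistency and termwise `O(1/√N)` perturbation
bounds).  Its EXPECTATION is computable exactly at equilibrium, for every Markov kernel, in terms of the true
autocovariances `γ_v = autocov κ π (f − π f) v`, and for flow-MCMC (`indepMH q w`, `w` normalised, maximal at `x₀`,
`w = w(x₀)`, all `γ_v ≥ 0` with `σ²_f = γ_0 + 2Σ_{v≥1}γ_v ≤ (2w − 1)·Var_π f`) the bias is `O(1/N)` with an explicit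
constant:

* §1 **`lagSum_centred_eq`** — pathwise: with `a_i = f(X_i) − m` (any constant `m`), `ā = (1/N)Σ_{j<N} a_j`,
  `Σ_{i<M}(a_i − ā)(a_{i+u} − ā) = Σ_{i<M} a_i a_{i+u} − ā·(Σ_{i<M} a_i + Σ_{i<M} a_{i+u}) + M ā²`.
* §2 any Markov kernel at equilibrium: **`chain_pair_stationary`** `E_π[f̄(X_i)f̄(X_j)] = γ_{|i−j|}`;
  **`chain_lagSum_centred_stationary_eq`** — for `u ≤ N`, `M = N − u`:
  `E_π[S_u] = M·γ_u − (1/N)·Σ_{i<M}Σ_{k<N}(γ_{|i−k|} + γ_{|i+u−k|}) + (M/N²)·Σ_{j,k<N}γ_{|j−k|}` EXACTLY.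
* §3 flow-MCMC: **`imh_rowSum_autocov_le`** — every row sum `Σ_{k<N} γ_{|j−k|} ≤ σ²_f`; hence
  **`imh_chain_lagSum_centred_bias`** — `−2M·σ²_f/N ≤ E_π[S_u] − M·γ_u ≤ M·σ²_f/N`, and with `σ²_f ≤ (2w − 1)V`
  (**`imh_chain_empiricalAutocov_bias`**): `|E_π[S_u/N] − ((N − u)/N)·γ_u| ≤ 2(2w − 1)·V/N` AT EVERY LAG — an `O(1/N)`
  certificate for the bias of the standard autocovariance estimator of an exact sampler's equilibrium run (the
  deterministic triangle factor `(N − u)/N` aside), where termwise perturbation only gives `O(1/√N)`.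

NOT CLAIMED: the cold-started version (it follows from GEN-32's pair law the same way, not written); the variance of
`S_u`; the windowed `τ̂_int` itself; any number for a specific weight.

No `sorry`, no new definitions, nothing cited as a fact; general measurable space with measurable singletons.
-/

noncomputable section

namespace Summit.Ventures.LatticeQCDFlow.Exactness

open MeasureTheory ProbabilityTheory Function Finset
open scoped ENNReal
open Summit.Ventures.LatticeQCDFlow.Scoring

variable {Ω : Type*} [MeasurableSpace Ω]

/-! ## §1 Pathwise -/

/-- **`Σ_{i<M}(a_i − ā)(a_{i+u} − ā) = Σ_{i<M} a_i a_{i+u} − ā(Σ_{i<M} a_i + Σ_{i<M} a_{i+u}) + M ā²`** for every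
sequence `a` and every real `ā`. [ours, algebra] -/
theorem lagSum_centred_eq (a : ℕ → ℝ) (abar : ℝ) (M u : ℕ) :
    ∑ i ∈ Finset.range M, (a i - abar) * (a (i + u) - abar) =
      ∑ i ∈ Finset.range M, a i * a (i + u) -
        abar * (∑ i ∈ Finset.range M, a i + ∑ i ∈ Finset.range M, a (i + u)) + M * abar ^ 2 := by
  have h : ∀ i ∈ Finset.range M, (a i - abar) * (a (i + u) - abar) =
      a i * a (i + u) - abar * (a i + a (i + u)) + abar ^ 2 := fun i _ => by ring
  rw [Finset.sum_congr rfl h, Finset.sum_add_distrib, Finset.sum_sub_distrib, ← Finset.mul_sum,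
    Finset.sum_add_distrib, Finset.sum_const, Finset.card_range, nsmul_eq_mul]

/-! ## §2 Any Markov kernel at equilibrium -/

section Stationary

variable (κ : Kernel Ω Ω) [IsMarkovKernel κ]

/-- **`E_π[g(X_i) g(X_j)] = autocov κ π g |i − j|`** for the equilibrium run and bounded measurable `g`. [ours,
bookkeeping] -/
theorem chain_pair_stationary {π : Measure Ω} [IsProbabilityMeasure π] (hπ : Kernel.Invariant κ π)
    {g : Ω → ℝ} (hg : Measurable g) {C : ℝ} (hC : ∀ x, |g x| ≤ C) (i j : ℕ) :
    ∫ x, g (x i) * g (x j) ∂(Kernel.trajMeasure (X := fun _ : ℕ => Ω) π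
        (fun n : ℕ => κ.comap (fun h : (i : ↥(Finset.Iic n)) → Ω => h ⟨n, Finset.mem_Iic.2 le_rfl⟩)
          (measurable_pi_apply _))) = autocov κ π g (Nat.dist i j) := by
  rcases le_total i j with hij | hji
  · obtain ⟨t, rfl⟩ := Nat.exists_eq_add_of_le hij
    rw [Nat.dist_eq_sub_of_le hij, Nat.add_sub_cancel_left]
    exact chain_autocov hπ hg hC i t
  · obtain ⟨t, rfl⟩ := Nat.exists_eq_add_of_le hji
    rw [Nat.dist_eq_sub_of_le_right hji, Nat.add_sub_cancel_left, ← chain_autocov hπ hg hC j t]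
    exact integral_congr_ae (ae_of_all _ fun x => mul_comm _ _)

/-- **THE EXPECTED EMPIRICALLY CENTRED LAG SUM AT EQUILIBRIUM, EXACTLY** (every Markov kernel `κ` with invariant
probability law `π`, bounded measurable `f`, `γ_v = autocov κ π (f − π f) v`, `u ≤ N`, `M = N − u`):
`E_π[Σ_{i<M}(f(X_i) − m_N)(f(X_{i+u}) − m_N)] = M γ_u − (1/N)Σ_{i<M}Σ_{k<N}(γ_{|i−k|} + γ_{|i+u−k|}) + (M/N²)Σ_{j,k<N}γ_{|j−k|}`.
[ours] -/
theorem chain_lagSum_centred_stationary_eq {π : Measure Ω} [IsProbabilityMeasure π] (hπ : Kernel.Invariant κ π)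
    {f : Ω → ℝ} (hf : Measurable f) {C : ℝ} (hC : ∀ x, |f x| ≤ C) {N : ℕ} (hN : N ≠ 0) (u : ℕ) :
    ∫ x, ∑ i ∈ Finset.range (N - u), (f (x i) - (∑ j ∈ Finset.range N, f (x j)) / N) *
        (f (x (i + u)) - (∑ j ∈ Finset.range N, f (x j)) / N)
        ∂(Kernel.trajMeasure (X := fun _ : ℕ => Ω) π
          (fun n : ℕ => κ.comap (fun h : (i : ↥(Finset.Iic n)) → Ω => h ⟨n, Finset.mem_Iic.2 le_rfl⟩)
            (measurable_pi_apply _))) =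
      (N - u : ℕ) * autocov κ π (fun x => f x - ∫ z, f z ∂π) u -
        (∑ i ∈ Finset.range (N - u), ∑ k ∈ Finset.range N,
            (autocov κ π (fun x => f x - ∫ z, f z ∂π) (Nat.dist i k) +
              autocov κ π (fun x => f x - ∫ z, f z ∂π) (Nat.dist (i + u) k))) / N +
        (N - u : ℕ) * ((∑ j ∈ Finset.range N, ∑ k ∈ Finset.range N,
            autocov κ π (fun x => f x - ∫ z, f z ∂π) (Nat.dist j k)) / (N : ℝ) ^ 2) := by
  set P := Kernel.trajMeasure (X := fun _ : ℕ => Ω) π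
      (fun n : ℕ => κ.comap (fun h : (i : ↥(Finset.Iic n)) → Ω => h ⟨n, Finset.mem_Iic.2 le_rfl⟩)
        (measurable_pi_apply _)) with hP
  set m := ∫ z, f z ∂π with hm
  set g : Ω → ℝ := fun x => f x - m with hgdef
  set M := N - u with hM
  have hN' : (N : ℝ) ≠ 0 := by exact_mod_cast hN
  have hgm : Measurable g := hf.sub measurable_const
  have hgb : ∀ x, |g x| ≤ C + |m| := fun x => (abs_sub _ _).trans (add_le_add (hC x) le_rfl)
  -- rewrite the integrand pathwise with `a_i = g(x_i)`, `ā = (1/N)Σ g(x_j) = m_N − m`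
  have hbar : ∀ x : ℕ → Ω, (∑ j ∈ Finset.range N, f (x j)) / N = m + (∑ j ∈ Finset.range N, g (x j)) / N := by
    intro x
    simp only [hgdef, Finset.sum_sub_distrib, Finset.sum_const, Finset.card_range, nsmul_eq_mul]
    field_simp
    ring
  have hpt : ∀ x : ℕ → Ω, ∑ i ∈ Finset.range M, (f (x i) - (∑ j ∈ Finset.range N, f (x j)) / N) *
      (f (x (i + u)) - (∑ j ∈ Finset.range N, f (x j)) / N) =
      ∑ i ∈ Finset.range M, g (x i) * g (x (i + u)) -
        (∑ j ∈ Finset.range N, g (x j)) / N *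
          (∑ i ∈ Finset.range M, g (x i) + ∑ i ∈ Finset.range M, g (x (i + u))) +
        M * ((∑ j ∈ Finset.range N, g (x j)) / N) ^ 2 := by
    intro x
    rw [hbar x, ← lagSum_centred_eq (fun i => g (x i)) ((∑ j ∈ Finset.range N, g (x j)) / N) M u]
    refine Finset.sum_congr rfl fun i _ => ?_
    simp only [hgdef]
    ring
  simp_rw [hpt]
  -- integrability of the three pieces
  have hI2 : ∀ i j, Integrable (fun x : ℕ → Ω => g (x i) * g (x j)) P := fun i j =>
    integrable_of_bounded P ((hgm.comp (measurable_pi_apply i)).mul (hgm.comp (measurable_pi_apply j)))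
      (C := (C + |m|) * (C + |m|)) fun x => by
        rw [abs_mul]; exact mul_le_mul (hgb (x i)) (hgb (x j)) (abs_nonneg _) ((abs_nonneg _).trans (hgb (x i)))
  have hA : Integrable (fun x : ℕ → Ω => ∑ i ∈ Finset.range M, g (x i) * g (x (i + u))) P :=
    integrable_finsetSum _ fun i _ => hI2 i (i + u)
  -- the cross term as a double sum
  have hcross : ∀ x : ℕ → Ω, (∑ j ∈ Finset.range N, g (x j)) / N *
      (∑ i ∈ Finset.range M, g (x i) + ∑ i ∈ Finset.range M, g (x (i + u))) =
      (∑ i ∈ Finset.range M, ∑ k ∈ Finset.range N, (g (x i) * g (x k) + g (x (i + u)) * g (x k))) / N := by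
    intro x
    rw [div_mul_eq_mul_div]
    congr 1
    rw [mul_add, Finset.mul_sum, Finset.mul_sum, ← Finset.sum_add_distrib]
    refine Finset.sum_congr rfl fun i _ => ?_
    rw [Finset.sum_add_distrib, Finset.sum_mul, Finset.sum_mul]
    congr 1 <;> exact Finset.sum_congr rfl fun k _ => by ring
  simp_rw [hcross]
  have hB : Integrable (fun x : ℕ → Ω => (∑ i ∈ Finset.range M, ∑ k ∈ Finset.range N,
      (g (x i) * g (x k) + g (x (i + u)) * g (x k))) / N) P := by
    refine Integrable.div_const (integrable_finsetSum _ fun i _ => integrable_finsetSum _ fun k _ => ?_) _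
    exact (hI2 i k).add (hI2 (i + u) k)
  -- the square of the centred mean
  have hsq : ∀ x : ℕ → Ω, (M : ℝ) * ((∑ j ∈ Finset.range N, g (x j)) / N) ^ 2 =
      M * ((∑ j ∈ Finset.range N, f (x j)) / N - m) ^ 2 := by
    intro x; rw [hbar x]; ring
  simp_rw [hsq]
  have hCm : Measurable fun x : ℕ → Ω => ((∑ j ∈ Finset.range N, f (x j)) / N - m) ^ 2 :=
    (((Finset.measurable_sum _ fun j _ => hf.comp (measurable_pi_apply j)).div_const _).sub
      measurable_const).pow_const 2
  have hCint : Integrable (fun x : ℕ → Ω => (M : ℝ) * ((∑ j ∈ Finset.range N, f (x j)) / N - m) ^ 2) P := by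
    refine (integrable_of_bounded P hCm (C := (C + |m|) ^ 2) fun x => ?_).const_mul _
    rw [abs_pow]
    exact pow_le_pow_left₀ (abs_nonneg _) ((abs_sub _ _).trans (add_le_add (abs_timeAverage_le hC hN x) le_rfl)) 2
  have hpair : ∀ i j, ∫ x, g (x i) * g (x j) ∂P = autocov κ π g (Nat.dist i j) := fun i j => by
    rw [hP]; exact chain_pair_stationary κ hπ hgm hgb i j
  have h1 : ∫ x, ∑ i ∈ Finset.range M, g (x i) * g (x (i + u)) ∂P = (M : ℝ) * autocov κ π g u := by
    rw [integral_finsetSum _ fun i _ => hI2 i (i + u)]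
    simp_rw [hpair, Nat.dist_eq_sub_of_le (Nat.le_add_right _ u), Nat.add_sub_cancel_left]
    rw [Finset.sum_const, Finset.card_range, nsmul_eq_mul]
  have h2 : ∫ x, (∑ i ∈ Finset.range M, ∑ k ∈ Finset.range N,
      (g (x i) * g (x k) + g (x (i + u)) * g (x k))) / N ∂P =
      (∑ i ∈ Finset.range M, ∑ k ∈ Finset.range N,
        (autocov κ π g (Nat.dist i k) + autocov κ π g (Nat.dist (i + u) k))) / N := by
    have hIk : ∀ i k, Integrable (fun x : ℕ → Ω => g (x i) * g (x k) + g (x (i + u)) * g (x k)) P :=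
      fun i k => (hI2 i k).add (hI2 (i + u) k)
    have hIrow : ∀ i, Integrable (fun x : ℕ → Ω => ∑ k ∈ Finset.range N,
        (g (x i) * g (x k) + g (x (i + u)) * g (x k))) P := fun i => integrable_finsetSum _ fun k _ => hIk i k
    rw [integral_div, integral_finsetSum _ fun i _ => hIrow i]
    congr 1
    refine Finset.sum_congr rfl fun i _ => ?_
    rw [integral_finsetSum _ fun k _ => hIk i k]
    refine Finset.sum_congr rfl fun k _ => ?_
    rw [integral_add (hI2 i k) (hI2 (i + u) k), hpair, hpair]
  have h3 : ∫ x, (M : ℝ) * ((∑ j ∈ Finset.range N, f (x j)) / N - m) ^ 2 ∂P =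
      M * ((∑ j ∈ Finset.range N, ∑ k ∈ Finset.range N, autocov κ π g (Nat.dist j k)) / (N : ℝ) ^ 2) := by
    rw [integral_const_mul, hP, hm]
    congr 1
    exact chain_mse_stationary_eq κ hπ hf hC hN
  have hAB : Integrable (fun x : ℕ → Ω => ∑ i ∈ Finset.range M, g (x i) * g (x (i + u)) -
      (∑ i ∈ Finset.range M, ∑ k ∈ Finset.range N, (g (x i) * g (x k) + g (x (i + u)) * g (x k))) / N) P :=
    hA.sub hB
  rw [integral_add hAB hCint, integral_sub hA hB, h1, h2, h3]

end Stationary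

/-! ## §3 Flow-MCMC: every row sum of autocovariances is at most `σ²_f`, so the bias is `O(σ²_f/N)` -/

omit [MeasurableSpace Ω] in
/-- **Row sums of a nonnegative lag function**: `Σ_{k<N} γ_{|j−k|} ≤ γ_0 + 2Σ_{v≥0} γ_{v+1}` for `γ ≥ 0` with summable
tail (each positive lag occurs at most twice in a row). [ours, combinatorics] -/
theorem rowSum_dist_le {γ : ℕ → ℝ} (h0 : ∀ v, 0 ≤ γ v) (hs : Summable fun v => γ (v + 1)) (j N : ℕ) :
    ∑ k ∈ Finset.range N, γ (Nat.dist j k) ≤ γ 0 + 2 * ∑' v, γ (v + 1) := by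
  -- enlarge the row to `k < (j + 1) + N` and split it at `j + 1`
  have hsub : Finset.range N ⊆ Finset.range (j + 1 + N) := Finset.range_subset_range.2 (by omega)
  have h1 : ∑ k ∈ Finset.range N, γ (Nat.dist j k) ≤ ∑ k ∈ Finset.range (j + 1 + N), γ (Nat.dist j k) :=
    Finset.sum_le_sum_of_subset_of_nonneg hsub fun k _ _ => h0 _
  rw [Finset.sum_range_add] at h1
  -- the part `k ≤ j`: lags `j, j−1, …, 0`
  have hleft : ∑ k ∈ Finset.range (j + 1), γ (Nat.dist j k) = ∑ v ∈ Finset.range (j + 1), γ v := by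
    rw [← Finset.sum_range_reflect (fun v => γ v) (j + 1)]
    refine Finset.sum_congr rfl fun k hk => ?_
    have hk' : k ≤ j := Nat.lt_succ_iff.1 (Finset.mem_range.1 hk)
    rw [Nat.dist_eq_sub_of_le_right hk', Nat.add_sub_cancel]
  -- the part `k > j`: lags `1, 2, …, N`
  have hright : ∑ v ∈ Finset.range N, γ (Nat.dist j (j + 1 + v)) = ∑ v ∈ Finset.range N, γ (v + 1) := by
    refine Finset.sum_congr rfl fun v _ => ?_
    rw [Nat.dist_eq_sub_of_le (by omega)]
    congr 1
    omega
  rw [hleft, hright, Finset.sum_range_succ'] at h1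
  have ha : ∑ v ∈ Finset.range j, γ (v + 1) ≤ ∑' v, γ (v + 1) :=
    hs.sum_le_tsum (Finset.range j) fun v _ => h0 _
  have hb : ∑ v ∈ Finset.range N, γ (v + 1) ≤ ∑' v, γ (v + 1) :=
    hs.sum_le_tsum (Finset.range N) fun v _ => h0 _
  linarith

variable [MeasurableSingletonClass Ω] {q : Measure Ω} [IsProbabilityMeasure q] {w : Ω → ℝ}

omit [MeasurableSingletonClass Ω] in
/-- **For flow-MCMC every row sum of autocovariances is at most `σ²_f = γ_0 + 2Σ_{v≥1}γ_v`** (`w` normalised, maximal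
at `x₀`; `γ_v = autocov K π (f − π f) v ≥ 0`, `γ_v ≤ r^v V`). [ours] -/
theorem imh_rowSum_autocov_le (hw : Measurable w) (hw0 : ∀ y, 0 < w y) {x₀ : Ω} (hmax : ∀ y, w y ≤ w x₀)
    [IsProbabilityMeasure (q.withDensity fun y => ENNReal.ofReal (w y))]
    {f : Ω → ℝ} (hf : Measurable f) {C : ℝ} (hC : ∀ x, |f x| ≤ C) (j N : ℕ) :
    ∑ k ∈ Finset.range N, autocov (indepMH q w) (q.withDensity fun y => ENNReal.ofReal (w y))
        (fun x => f x - ∫ z, f z ∂(q.withDensity fun y => ENNReal.ofReal (w y))) (Nat.dist j k) ≤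
      autocov (indepMH q w) (q.withDensity fun y => ENNReal.ofReal (w y))
          (fun x => f x - ∫ z, f z ∂(q.withDensity fun y => ENNReal.ofReal (w y))) 0 +
        2 * ∑' v, autocov (indepMH q w) (q.withDensity fun y => ENNReal.ofReal (w y))
          (fun x => f x - ∫ z, f z ∂(q.withDensity fun y => ENNReal.ofReal (w y))) (v + 1) := by
  have hW : 1 ≤ w x₀ := one_le_of_mode (q := q) hmax
  have hr0 : 0 ≤ 1 - (w x₀)⁻¹ := sub_nonneg.2 (inv_le_one_of_one_le₀ hW)
  have hr1 : 1 - (w x₀)⁻¹ < 1 := sub_lt_self _ (inv_pos.2 (hw0 x₀))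
  have hb := fun u => imh_autocov_centred_bounds (q := q) hw hw0 hmax hf hC u (x₀ := x₀)
  have hs : Summable fun v => autocov (indepMH q w) (q.withDensity fun y => ENNReal.ofReal (w y))
      (fun x => f x - ∫ z, f z ∂(q.withDensity fun y => ENNReal.ofReal (w y))) (v + 1) := by
    refine Summable.of_nonneg_of_le (fun v => (hb (v + 1)).1) (fun v => (hb (v + 1)).2) ?_
    exact (summable_nat_add_iff 1).2 ((summable_geometric_of_lt_one hr0 hr1).mul_right _)
  exact rowSum_dist_le (fun v => (hb v).1) hs j N

omit [MeasurableSingletonClass Ω] in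
/-- **THE BIAS OF THE EMPIRICALLY CENTRED LAG SUM IS `O(σ²_f/N)`**: for flow-MCMC at equilibrium, `u ≤ N`,
`M = N − u`, `σ²_f = γ_0 + 2Σ_{v≥1}γ_v`:
`−2M·σ²_f/N ≤ E_π[Σ_{i<M}(f(X_i) − m_N)(f(X_{i+u}) − m_N)] − M·γ_u ≤ M·σ²_f/N`. [ours] -/
theorem imh_chain_lagSum_centred_bias [Fact (Measurable w)] (hw0 : ∀ y, 0 < w y) {x₀ : Ω}
    (hmax : ∀ y, w y ≤ w x₀) [IsProbabilityMeasure (q.withDensity fun y => ENNReal.ofReal (w y))]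
    {f : Ω → ℝ} (hf : Measurable f) {C : ℝ} (hC : ∀ x, |f x| ≤ C) {N : ℕ} (hN : N ≠ 0) (u : ℕ) :
    -(2 * (N - u : ℕ) *
        (autocov (indepMH q w) (q.withDensity fun y => ENNReal.ofReal (w y))
            (fun x => f x - ∫ z, f z ∂(q.withDensity fun y => ENNReal.ofReal (w y))) 0 +
          2 * ∑' v, autocov (indepMH q w) (q.withDensity fun y => ENNReal.ofReal (w y))
            (fun x => f x - ∫ z, f z ∂(q.withDensity fun y => ENNReal.ofReal (w y))) (v + 1)) / N) ≤
      ∫ x, ∑ i ∈ Finset.range (N - u), (f (x i) - (∑ j ∈ Finset.range N, f (x j)) / N) *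
          (f (x (i + u)) - (∑ j ∈ Finset.range N, f (x j)) / N)
          ∂(Kernel.trajMeasure (X := fun _ : ℕ => Ω) (q.withDensity fun y => ENNReal.ofReal (w y))
            (fun n : ℕ => (indepMH q w).comap (fun h : (i : ↥(Finset.Iic n)) → Ω => h ⟨n, Finset.mem_Iic.2 le_rfl⟩)
              (measurable_pi_apply _))) -
        (N - u : ℕ) * autocov (indepMH q w) (q.withDensity fun y => ENNReal.ofReal (w y))
          (fun x => f x - ∫ z, f z ∂(q.withDensity fun y => ENNReal.ofReal (w y))) u ∧
    ∫ x, ∑ i ∈ Finset.range (N - u), (f (x i) - (∑ j ∈ Finset.range N, f (x j)) / N) *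
          (f (x (i + u)) - (∑ j ∈ Finset.range N, f (x j)) / N)
          ∂(Kernel.trajMeasure (X := fun _ : ℕ => Ω) (q.withDensity fun y => ENNReal.ofReal (w y))
            (fun n : ℕ => (indepMH q w).comap (fun h : (i : ↥(Finset.Iic n)) → Ω => h ⟨n, Finset.mem_Iic.2 le_rfl⟩)
              (measurable_pi_apply _))) -
        (N - u : ℕ) * autocov (indepMH q w) (q.withDensity fun y => ENNReal.ofReal (w y))
          (fun x => f x - ∫ z, f z ∂(q.withDensity fun y => ENNReal.ofReal (w y))) u ≤
      (N - u : ℕ) *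
        (autocov (indepMH q w) (q.withDensity fun y => ENNReal.ofReal (w y))
            (fun x => f x - ∫ z, f z ∂(q.withDensity fun y => ENNReal.ofReal (w y))) 0 +
          2 * ∑' v, autocov (indepMH q w) (q.withDensity fun y => ENNReal.ofReal (w y))
            (fun x => f x - ∫ z, f z ∂(q.withDensity fun y => ENNReal.ofReal (w y))) (v + 1)) / N := by
  have hw : Measurable w := Fact.out
  have hπK : Kernel.Invariant (indepMH q w) (q.withDensity fun y => ENNReal.ofReal (w y)) :=
    indepMH_invariant (q := q) hw hw0
  have hNpos : (0 : ℝ) < N := by exact_mod_cast Nat.pos_of_ne_zero hN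
  have hM0 : (0 : ℝ) ≤ (N - u : ℕ) := Nat.cast_nonneg _
  rw [chain_lagSum_centred_stationary_eq (indepMH q w) hπK hf hC hN u]
  set γ : ℕ → ℝ := fun v => autocov (indepMH q w) (q.withDensity fun y => ENNReal.ofReal (w y))
      (fun x => f x - ∫ z, f z ∂(q.withDensity fun y => ENNReal.ofReal (w y))) v with hγ
  set σ2 := γ 0 + 2 * ∑' v, γ (v + 1) with hσ2
  have hrow : ∀ j, ∑ k ∈ Finset.range N, γ (Nat.dist j k) ≤ σ2 := fun j =>
    imh_rowSum_autocov_le (q := q) hw hw0 hmax hf hC j N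
  have hγ0 : ∀ v, 0 ≤ γ v := fun v => (imh_autocov_centred_bounds (q := q) hw hw0 hmax hf hC v).1
  -- the cross double sum is in `[0, 2Mσ²]`, the full double sum in `[0, Nσ²]`
  have hR1 : ∑ i ∈ Finset.range (N - u), ∑ k ∈ Finset.range N, (γ (Nat.dist i k) + γ (Nat.dist (i + u) k)) ≤
      (N - u : ℕ) * (2 * σ2) := by
    have h := Finset.sum_le_sum (s := Finset.range (N - u)) fun i _ => (show
      ∑ k ∈ Finset.range N, (γ (Nat.dist i k) + γ (Nat.dist (i + u) k)) ≤ 2 * σ2 by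
        rw [Finset.sum_add_distrib]; linarith [hrow i, hrow (i + u)])
    rwa [Finset.sum_const, Finset.card_range, nsmul_eq_mul] at h
  have hR0 : 0 ≤ ∑ i ∈ Finset.range (N - u), ∑ k ∈ Finset.range N, (γ (Nat.dist i k) + γ (Nat.dist (i + u) k)) :=
    Finset.sum_nonneg fun i _ => Finset.sum_nonneg fun k _ => add_nonneg (hγ0 _) (hγ0 _)
  have hS1 : ∑ j ∈ Finset.range N, ∑ k ∈ Finset.range N, γ (Nat.dist j k) ≤ N * σ2 := by
    have h := Finset.sum_le_sum (s := Finset.range N) fun j _ => hrow j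
    rwa [Finset.sum_const, Finset.card_range, nsmul_eq_mul] at h
  have hS0 : 0 ≤ ∑ j ∈ Finset.range N, ∑ k ∈ Finset.range N, γ (Nat.dist j k) :=
    Finset.sum_nonneg fun j _ => Finset.sum_nonneg fun k _ => hγ0 _
  have hN2 : (0 : ℝ) < (N : ℝ) ^ 2 := by positivity
  constructor
  · -- lower: drop the (nonnegative) squared-mean term, bound the cross term by `2Mσ²/N`
    have h1 : (∑ i ∈ Finset.range (N - u), ∑ k ∈ Finset.range N, (γ (Nat.dist i k) + γ (Nat.dist (i + u) k))) / N ≤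
        (N - u : ℕ) * (2 * σ2) / N := div_le_div_of_nonneg_right hR1 hNpos.le
    have h2 : 0 ≤ (N - u : ℕ) * ((∑ j ∈ Finset.range N, ∑ k ∈ Finset.range N, γ (Nat.dist j k)) / (N : ℝ) ^ 2) :=
      mul_nonneg hM0 (div_nonneg hS0 hN2.le)
    have h3 : (N - u : ℕ) * (2 * σ2) / N = 2 * (N - u : ℕ) * σ2 / N := by ring
    linarith
  · -- upper: drop the (nonnegative) cross term, bound the squared-mean term by `Mσ²/N`
    have h1 : 0 ≤ (∑ i ∈ Finset.range (N - u), ∑ k ∈ Finset.range N, (γ (Nat.dist i k) + γ (Nat.dist (i + u) k))) / N :=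
      div_nonneg hR0 hNpos.le
    have h2 : (N - u : ℕ) * ((∑ j ∈ Finset.range N, ∑ k ∈ Finset.range N, γ (Nat.dist j k)) / (N : ℝ) ^ 2) ≤
        (N - u : ℕ) * (N * σ2 / (N : ℝ) ^ 2) :=
      mul_le_mul_of_nonneg_left (div_le_div_of_nonneg_right hS1 hN2.le) hM0
    have h3 : (N - u : ℕ) * (N * σ2 / (N : ℝ) ^ 2) = (N - u : ℕ) * σ2 / N := by
      field_simp
    linarith

omit [MeasurableSingletonClass Ω] in
/-- **`|E_π[S_u/N] − ((N − u)/N)·γ_u| ≤ 2(2w − 1)·Var_π f/N` AT EVERY LAG** — the standard autocovariance estimator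
of an exact sampler's equilibrium run is biased by `O(1/N)` with the explicit constant `2(2w − 1)Var` (`σ²_f ≤
(2w − 1)V`, GEN-32 `imh_greenKubo_le`). [ours] -/
theorem imh_chain_empiricalAutocov_bias [Fact (Measurable w)] (hw0 : ∀ y, 0 < w y) {x₀ : Ω}
    (hmax : ∀ y, w y ≤ w x₀) [IsProbabilityMeasure (q.withDensity fun y => ENNReal.ofReal (w y))]
    {f : Ω → ℝ} (hf : Measurable f) {C : ℝ} (hC : ∀ x, |f x| ≤ C) {N : ℕ} (hN : N ≠ 0) (u : ℕ) :
    |(∫ x, ∑ i ∈ Finset.range (N - u), (f (x i) - (∑ j ∈ Finset.range N, f (x j)) / N) *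
          (f (x (i + u)) - (∑ j ∈ Finset.range N, f (x j)) / N)
          ∂(Kernel.trajMeasure (X := fun _ : ℕ => Ω) (q.withDensity fun y => ENNReal.ofReal (w y))
            (fun n : ℕ => (indepMH q w).comap (fun h : (i : ↥(Finset.Iic n)) → Ω => h ⟨n, Finset.mem_Iic.2 le_rfl⟩)
              (measurable_pi_apply _)))) / N -
        ((N - u : ℕ) : ℝ) / N * autocov (indepMH q w) (q.withDensity fun y => ENNReal.ofReal (w y))
          (fun x => f x - ∫ z, f z ∂(q.withDensity fun y => ENNReal.ofReal (w y))) u| ≤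
      2 * (2 * w x₀ - 1) * (∫ x, (f x - ∫ z, f z ∂(q.withDensity fun y => ENNReal.ofReal (w y))) ^ 2
        ∂(q.withDensity fun y => ENNReal.ofReal (w y))) / N := by
  have hw : Measurable w := Fact.out
  have hNpos : (0 : ℝ) < N := by exact_mod_cast Nat.pos_of_ne_zero hN
  have hMN : ((N - u : ℕ) : ℝ) ≤ N := by exact_mod_cast Nat.sub_le N u
  have hM0 : (0 : ℝ) ≤ (N - u : ℕ) := Nat.cast_nonneg _
  obtain ⟨hlo, hhi⟩ := imh_chain_lagSum_centred_bias (q := q) hw0 hmax hf hC hN u (x₀ := x₀)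
  have hGK := imh_greenKubo_le (q := q) hw hw0 hmax hf hC (x₀ := x₀)
  have hσ0 : 0 ≤ autocov (indepMH q w) (q.withDensity fun y => ENNReal.ofReal (w y))
        (fun x => f x - ∫ z, f z ∂(q.withDensity fun y => ENNReal.ofReal (w y))) 0 +
      2 * ∑' v, autocov (indepMH q w) (q.withDensity fun y => ENNReal.ofReal (w y))
        (fun x => f x - ∫ z, f z ∂(q.withDensity fun y => ENNReal.ofReal (w y))) (v + 1) := by
    have hb := fun u => imh_autocov_centred_bounds (q := q) hw hw0 hmax hf hC u (x₀ := x₀)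
    exact add_nonneg (hb 0).1 (mul_nonneg zero_le_two (tsum_nonneg fun v => (hb (v + 1)).1))
  set E := ∫ x, ∑ i ∈ Finset.range (N - u), (f (x i) - (∑ j ∈ Finset.range N, f (x j)) / N) *
      (f (x (i + u)) - (∑ j ∈ Finset.range N, f (x j)) / N)
      ∂(Kernel.trajMeasure (X := fun _ : ℕ => Ω) (q.withDensity fun y => ENNReal.ofReal (w y))
        (fun n : ℕ => (indepMH q w).comap (fun h : (i : ↥(Finset.Iic n)) → Ω => h ⟨n, Finset.mem_Iic.2 le_rfl⟩)
          (measurable_pi_apply _))) with hE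
  set σ2 := autocov (indepMH q w) (q.withDensity fun y => ENNReal.ofReal (w y))
        (fun x => f x - ∫ z, f z ∂(q.withDensity fun y => ENNReal.ofReal (w y))) 0 +
      2 * ∑' v, autocov (indepMH q w) (q.withDensity fun y => ENNReal.ofReal (w y))
        (fun x => f x - ∫ z, f z ∂(q.withDensity fun y => ENNReal.ofReal (w y))) (v + 1) with hσ2
  set V := ∫ x, (f x - ∫ z, f z ∂(q.withDensity fun y => ENNReal.ofReal (w y))) ^ 2
      ∂(q.withDensity fun y => ENNReal.ofReal (w y)) with hV
  set γu := autocov (indepMH q w) (q.withDensity fun y => ENNReal.ofReal (w y))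
      (fun x => f x - ∫ z, f z ∂(q.withDensity fun y => ENNReal.ofReal (w y))) u with hγu
  -- divide the two-sided bound by `N` and enlarge `M ≤ N`, `σ² ≤ (2w − 1)V`
  have hkey : |E / N - ((N - u : ℕ) : ℝ) / N * γu| = |E - (N - u : ℕ) * γu| / N := by
    rw [← abs_of_pos hNpos, ← abs_div, abs_of_pos hNpos]
    congr 1
    field_simp
  rw [hkey, div_le_div_iff_of_pos_right hNpos, abs_le]
  have hup : (N - u : ℕ) * σ2 / N ≤ 2 * (2 * w x₀ - 1) * V := by
    have h1 : (N - u : ℕ) * σ2 / N ≤ σ2 := by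
      rw [div_le_iff₀ hNpos]; nlinarith
    nlinarith
  have hdown : 2 * (N - u : ℕ) * σ2 / N ≤ 2 * (2 * w x₀ - 1) * V := by
    have h1 : 2 * (N - u : ℕ) * σ2 / N ≤ 2 * σ2 := by
      rw [div_le_iff₀ hNpos]; nlinarith
    nlinarith
  constructor <;> linarith

end Summit.Ventures.LatticeQCDFlow.Exactness
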